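import Literature.Computability.AlgebraicComplexity.AlmanLi2026FreeLunchSpeedup
import Literature.Computability.AlgebraicComplexity.AlmanLi2026OneSliceRankCount
import Literature.Computability.AlgebraicComplexity.BlockSliceTensor
import HarnessLib

/-!
# The free lunch with a BLOCK functional (Alman–Li 2026, Thm. 5.1 + Prop. 5.3 blockwise: the engine of Lemma 7.2 and of the second proof of Thm. 6.3)

Topic `Literature/Computability/AlgebraicComplexity` (family `MatrixMultiplication`). Source: J. Alman,
B. Li, *Asymptotic Rank Speedup Theorems, Revisited*, arXiv:2605.21738 (2026) (held text
`paper:arxiv-2605.21738`): the second proof of Thm. 6.3 (p. 16 L14–55) and the proof of Lemma 7.2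
(p. 18 L80 – p. 19 L12), both of which apply the free-lunch speedup theorem (Thm. 5.1) with a
MULTI-dimensional `C'` spanned by functionals `w ↦ w'_α` (one per block `α`) whose contractions
`(id ⊗ id ⊗ f_α) S` live on pairwise DISJOINT sets of `u`- and `v`-variables, and then count ranks
block by block: "`({id} ⊗ {id} ⊗ C')S = ∑_α (…) w'_α` … after applying the contraction `A' ⊗ B'`, each
summand `⟨1,(d_α+1)d²,1⟩` restricts to `⟨1,(d_α−1)d²,1⟩`" (p. 19 L3–11); "the annihilators `A'`, `B'`
split as products over `α` because block `α`'s equations only involve the variables in the support of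
`M_α`" (p. 16 L52–54, paraphrased in `ALMANLI-SPEEDUP-NOTE`).

## The form proved here (`AlmanLi2026.freeLunch_blockFunctional`, any field)

Let `T = (A ⊗ B ⊗ C) S` be a restriction (`n = |ι'|` rows of `A`, `m = |κ'|` rows of `B`) and let
`f : P → (μ → K)` be functionals with
* `(A ⊗ B ⊗ f_γ) S = 0` for every `γ` (each `f_γ ∈ C^⊥`), and
* DISJOINT SUPPORTS: there are labellings `rowLab : ι → P`, `colLab : κ → P` such that the matrix
  `M_γ = (id ⊗ id ⊗ f_γ) S` vanishes outside the rows labelled `γ` and outside the columns labelled `γ`.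
Then `T ⊕ ⊕_γ ⟨1, q_γ − n − m, 1⟩ ⊴ S`, `q_γ = rank M_γ`, the family direct sum being
`blockSliceTensor K Sigma.fst` on `Σ γ, Fin (q_γ − (n+m))` (`BlockSliceTensor.lean`).

Proof (the printed mechanism made explicit): for each `γ` ALONE, Prop. 5.3 (`prop53_rank`: the two
annihilators of `f_γ` have codimension `≤ m`, `≤ n`) and the rank-revealing restriction
(`restrictsTo_oneSlice_of_flattening_rank_eq`) give vectors `u^γ_1..u^γ_t`, `v^γ_1..v^γ_t`
(`t = q_γ − n − m`) in the two `f_γ`-annihilators with `(u^γ_k ⊗ v^γ_l ⊗ f_γ) S = δ_{kl}`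
(`exists_annihilator_vectors`). Truncating `u^γ_k` to the rows labelled `γ` (and `v^γ_l` to the columns
labelled `γ`) keeps all this (the `f_γ`-equations only see those coordinates) and puts the vectors in
the annihilators of every OTHER `f_β` too (whose equations only see coordinates labelled `β`); so the
truncated families are admissible rows `A''`, `B''` for Thm. 5.1 (`thm51`) with `C' = (f_γ)_γ`, and
`(A'' ⊗ B'' ⊗ C') S` is exactly the block one-slice tensor.

## References

* J. Alman, B. Li, arXiv:2605.21738 (2026), Thm. 5.1, Prop. 5.3, Thm. 6.3 (second proof), Lemma 7.2
  (proof). [AlmanLi2026]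
-/

noncomputable section

open scoped BigOperators

namespace Literature.Computability.AlgebraicComplexity

universe u

variable {K : Type u}
variable {ι κ μ ι' κ' μ' P : Type*}

namespace AlmanLi2026

/-! ## Folding the third index -/

/-- `∑_{a,b,c} w_a g_b f_c S_{abc} = ∑_{a,b} w_a g_b (M_f)_{ab}`, `M_f = (id ⊗ id ⊗ f) S`. [folklore] -/
private theorem fold3 [CommSemiring K] [Fintype ι] [Fintype κ] [Fintype μ] (w : ι → K) (g : κ → K)
    (f : μ → K) (S : ι → κ → μ → K) :
    (∑ a, ∑ b, ∑ c, w a * g b * f c * S a b c) = ∑ a, ∑ b, w a * g b * ∑ c, f c * S a b c := by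
  simp only [Finset.mul_sum]
  refine Finset.sum_congr rfl fun a _ => Finset.sum_congr rfl fun b _ =>
    Finset.sum_congr rfl fun c _ => ?_
  ring

/-- `∑_{a,b,c} U_{ka} V_{lb} f_c S_{abc} = (U M_f Vᵀ)_{kl}`. [folklore] -/
private theorem sum3_eq_mul_apply [CommSemiring K] [Fintype ι] [Fintype κ] [Fintype μ] {α β : Type*}
    (U : α → ι → K) (V : β → κ → K) (f : μ → K) (S : ι → κ → μ → K) (k : α) (l : β) :
    (∑ a, ∑ b, ∑ c, U k a * V l b * f c * S a b c) =
      (Matrix.of U * Matrix.of (fun a b => ∑ c, f c * S a b c) * (Matrix.of V).transpose) k l := by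
  rw [fold3]
  simp only [Matrix.mul_apply, Matrix.transpose_apply, Matrix.of_apply, Finset.sum_mul]
  rw [Finset.sum_comm]
  refine Finset.sum_congr rfl fun b _ => Finset.sum_congr rfl fun a _ => ?_
  ring

/-! ## One functional: vectors in the two annihilators contracting to an identity of size `q − n − m` -/

/-- `⟨1,r,1⟩ ≥ ⟨1,t,1⟩` for `t ≤ r` (trivial mode third). [cite: AlmanLi2026, §5.4] -/
private theorem restrictsTo_rotate_oneSlice_castLE [CommSemiring K] {t r : ℕ} (h : t ≤ r) :
    TensorRestrictsTo (rotate (oneSliceTensor K (Fin r))) (rotate (oneSliceTensor K (Fin t))) := by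
  rw [← blockSliceTensor_const, ← blockSliceTensor_const]
  exact tensorRestrictsTo_blockSliceTensor_of_comp_eq (e := Fin.castLE h) (f := id)
    (Fin.castLE_injective h) Function.injective_id (fun _ => rfl)

/-- **Alman–Li 2026, Prop. 5.3 with bases chosen**: for restriction data `A` (`n` rows), `B` (`m` rows)
on `S` and ONE functional `f` with `q = rank (id ⊗ id ⊗ f) S`, there are `t = q − n − m` vectors `u_k`
in the annihilator `{u : (u ⊗ B ⊗ f) S = 0}` and `t` vectors `v_l` in `{v : (A ⊗ v ⊗ f) S = 0}` with
`(u_k ⊗ v_l ⊗ f) S = δ_{kl}` (the restriction `T' ≥ ⟨1,t,1⟩` of Prop. 5.3 written out on vectors).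
[cite: AlmanLi2026, Prop. 5.3 (proof)] -/
theorem exists_annihilator_vectors [Field K] [Fintype ι] [Fintype κ] [Fintype μ] [Fintype ι']
    [Fintype κ'] (S : ι → κ → μ → K) (A : ι' → ι → K) (B : κ' → κ → K) (f : μ → K) :
    ∃ (u : Fin ((Matrix.of fun a b => ∑ c, f c * S a b c).rank - (Fintype.card ι' + Fintype.card κ'))
        → ι → K)
      (v : Fin ((Matrix.of fun a b => ∑ c, f c * S a b c).rank - (Fintype.card ι' + Fintype.card κ'))
        → κ → K),
      (∀ k b', (∑ a, ∑ b, ∑ c, u k a * B b' b * f c * S a b c) = 0) ∧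
      (∀ a' l, (∑ a, ∑ b, ∑ c, A a' a * v l b * f c * S a b c) = 0) ∧
      (∀ k l, (∑ a, ∑ b, ∑ c, u k a * v l b * f c * S a b c) = if k = l then 1 else 0) := by
  classical
  -- the two annihilators, with bases as rows (as in `freeLunch_oneFunctional`)
  set VA := LinearMap.ker (Matrix.of fun (b' : κ') (x : ι) =>
    ∑ y, ∑ w, B b' y * f w * S x y w).mulVecLin with hVA
  set VB := LinearMap.ker (Matrix.of fun (a' : ι') (y : κ) =>
    ∑ x, ∑ w, A a' x * f w * S x y w).mulVecLin with hVB
  set bA := Module.finBasis K VA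
  set bB := Module.finBasis K VB
  set A'' : Fin (Module.finrank K VA) → ι → K := fun x => ((bA x : VA) : ι → K) with hA''
  set B'' : Fin (Module.finrank K VB) → κ → K := fun y => ((bB y : VB) : κ → K) with hB''
  set T'' : Fin (Module.finrank K VA) → Fin (Module.finrank K VB) → Unit → K :=
    fun x y _ => ∑ a, ∑ b, ∑ c, A'' x a * B'' y b * f c * S a b c with hT''
  have hA''span : ∀ u : ι → K,
      (∀ b', (∑ a, ∑ b, ∑ c, u a * B b' b * f c * S a b c) = 0) →
        u ∈ Submodule.span K (Set.range A'') := by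
    intro u hu
    have hmem : u ∈ VA := (mem_ker_annihilatorA_iff S B f u).2 hu
    have hspan : Submodule.span K (Set.range A'') = VA := by
      have h := congrArg (Submodule.map VA.subtype) bA.span_eq
      rwa [Submodule.map_span, ← Set.range_comp, Submodule.map_subtype_top] at h
    rw [hspan]
    exact hmem
  have hB''span : ∀ v : κ → K,
      (∀ a', (∑ a, ∑ b, ∑ c, A a' a * v b * f c * S a b c) = 0) →
        v ∈ Submodule.span K (Set.range B'') := by
    intro v hv
    have hmem : v ∈ VB := (mem_ker_annihilatorB_iff S A f v).2 hv
    have hspan : Submodule.span K (Set.range B'') = VB := by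
      have h := congrArg (Submodule.map VB.subtype) bB.span_eq
      rwa [Submodule.map_span, ← Set.range_comp, Submodule.map_subtype_top] at h
    rw [hspan]
    exact hmem
  -- Prop. 5.3: the matrix of `T''` has rank `≥ q − n − m`, so `T'' ≥ ⟨1, q − n − m, 1⟩`
  have hrank := prop53_rank (T' := T'') (fun x y z => by rw [hT'']) hA''span hB''span
  obtain ⟨X, Y, Z, hXYZ⟩ := (restrictsTo_oneSlice_of_flattening_rank_eq T'' rfl).trans
    (restrictsTo_rotate_oneSlice_castLE (K := K)
      (t := (Matrix.of fun a b => ∑ c, f c * S a b c).rank - (Fintype.card ι' + Fintype.card κ'))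
      (r := (Matrix.of fun x y => T'' x y ()).rank) (by omega))
  refine ⟨fun k a => Z () () * ∑ x, X k x * A'' x a, fun l b => ∑ y, Y l y * B'' y b, ?_, ?_, ?_⟩
  · -- linear combinations of the `A''`-rows stay in the annihilator `VA`
    intro k b'
    have hmem : (fun a => Z () () * ∑ x, X k x * A'' x a) ∈ VA := by
      have e : (fun a => Z () () * ∑ x, X k x * A'' x a) =
          Z () () • ∑ x, X k x • ((bA x : VA) : ι → K) := by
        funext a
        simp only [hA'', Pi.smul_apply, Finset.sum_apply, smul_eq_mul]
      rw [e]
      exact VA.smul_mem _ (Submodule.sum_mem _ fun x _ => VA.smul_mem _ (bA x).2)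
    exact (mem_ker_annihilatorA_iff S B f _).1 hmem b'
  · intro a' l
    have hmem : (fun b => ∑ y, Y l y * B'' y b) ∈ VB := by
      have e : (fun b => ∑ y, Y l y * B'' y b) = ∑ y, Y l y • ((bB y : VB) : κ → K) := by
        funext b
        simp only [hB'', Pi.smul_apply, Finset.sum_apply, smul_eq_mul]
      rw [e]
      exact Submodule.sum_mem _ fun y _ => VB.smul_mem _ (bB y).2
    exact (mem_ker_annihilatorB_iff S A f _).1 hmem a'
  · -- `(u_k ⊗ v_l ⊗ f) S = Z · (X · T''-matrix · Yᵀ)_{kl} = δ_{kl}`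
    intro k l
    have h1 := hXYZ k l ()
    simp only [rotate_apply, oneSliceTensor_apply, Fintype.sum_unique] at h1
    -- `h1 : (if k = l then 1 else 0) = ∑ x, ∑ y, X k x * Y l y * Z () () * T'' x y ()`
    have hTM : ∀ x y, T'' x y () = (Matrix.of A'' * Matrix.of (fun a b => ∑ c, f c * S a b c) *
        (Matrix.of B'').transpose) x y := fun x y => by
      rw [hT'']
      exact sum3_eq_mul_apply A'' B'' f S x y
    have hu : Matrix.of (fun k a => Z () () * ∑ x, X k x * A'' x a) =
        Z () () • (Matrix.of X * Matrix.of A'') := by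
      ext k a
      simp [Matrix.mul_apply]
    have hv : Matrix.of (fun l b => ∑ y, Y l y * B'' y b) = Matrix.of Y * Matrix.of B'' := by
      ext l b
      simp [Matrix.mul_apply]
    refine (sum3_eq_mul_apply (fun k a => Z () () * ∑ x, X k x * A'' x a)
      (fun l b => ∑ y, Y l y * B'' y b) f S k l).trans ?_
    rw [hu, hv, h1, Matrix.transpose_mul, Matrix.smul_mul, Matrix.smul_mul, Matrix.smul_apply,
      smul_eq_mul]
    rw [show Matrix.of X * Matrix.of A'' * Matrix.of (fun a b => ∑ c, f c * S a b c) *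
        ((Matrix.of B'').transpose * (Matrix.of Y).transpose) =
        Matrix.of X * (Matrix.of A'' * Matrix.of (fun a b => ∑ c, f c * S a b c) *
          (Matrix.of B'').transpose) * (Matrix.of Y).transpose by
      simp only [Matrix.mul_assoc]]
    simp only [Matrix.mul_apply, Matrix.transpose_apply, Matrix.of_apply, ← hTM, Finset.mul_sum,
      Finset.sum_mul]
    rw [Finset.sum_comm]
    refine Finset.sum_congr rfl fun x _ => Finset.sum_congr rfl fun y _ => ?_
    ring

/-! ## Truncating vectors to a block of rows / columns -/

section Trunc

variable [CommSemiring K] [Fintype ι] [Fintype κ] [Fintype μ] [DecidableEq P]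
  {S : ι → κ → μ → K} {f : P → μ → K} {rowLab : ι → P} {colLab : κ → P}

/-- Rows not labelled `γ` do not see `f_γ`: truncating `w` to the rows labelled `γ` does not change
`(w ⊗ g ⊗ f_γ) S`. [cite: AlmanLi2026, Thm. 6.3 (second proof: block equations involve only block variables)] -/
private theorem sum3_rowTrunc_self (hU : ∀ γ a b, rowLab a ≠ γ → (∑ c, f γ c * S a b c) = 0)
    (γ : P) (w : ι → K) (g : κ → K) :
    (∑ a, ∑ b, ∑ c, (if rowLab a = γ then w a else 0) * g b * f γ c * S a b c) =
      ∑ a, ∑ b, ∑ c, w a * g b * f γ c * S a b c := by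
  rw [fold3, fold3]
  refine Finset.sum_congr rfl fun a _ => Finset.sum_congr rfl fun b _ => ?_
  by_cases h : rowLab a = γ
  · rw [if_pos h]
  · rw [if_neg h, hU γ a b h]; simp

/-- … and makes `(w ⊗ g ⊗ f_β) S` vanish for every other `β`. [cite: AlmanLi2026, Thm. 6.3 (second proof)] -/
private theorem sum3_rowTrunc_ne (hU : ∀ γ a b, rowLab a ≠ γ → (∑ c, f γ c * S a b c) = 0)
    {γ β : P} (hne : γ ≠ β) (w : ι → K) (g : κ → K) :
    (∑ a, ∑ b, ∑ c, (if rowLab a = γ then w a else 0) * g b * f β c * S a b c) = 0 := by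
  rw [fold3]
  refine Finset.sum_eq_zero fun a _ => Finset.sum_eq_zero fun b _ => ?_
  by_cases h : rowLab a = γ
  · rw [hU β a b (by rw [h]; exact hne)]; simp
  · rw [if_neg h]; simp

/-- Column version of `sum3_rowTrunc_self`. [cite: AlmanLi2026, Thm. 6.3 (second proof)] -/
private theorem sum3_colTrunc_self (hV : ∀ γ a b, colLab b ≠ γ → (∑ c, f γ c * S a b c) = 0)
    (γ : P) (w : ι → K) (g : κ → K) :
    (∑ a, ∑ b, ∑ c, w a * (if colLab b = γ then g b else 0) * f γ c * S a b c) =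
      ∑ a, ∑ b, ∑ c, w a * g b * f γ c * S a b c := by
  rw [fold3, fold3]
  refine Finset.sum_congr rfl fun a _ => Finset.sum_congr rfl fun b _ => ?_
  by_cases h : colLab b = γ
  · rw [if_pos h]
  · rw [if_neg h, hV γ a b h]; simp

/-- Column version of `sum3_rowTrunc_ne`. [cite: AlmanLi2026, Thm. 6.3 (second proof)] -/
private theorem sum3_colTrunc_ne (hV : ∀ γ a b, colLab b ≠ γ → (∑ c, f γ c * S a b c) = 0)
    {γ β : P} (hne : γ ≠ β) (w : ι → K) (g : κ → K) :
    (∑ a, ∑ b, ∑ c, w a * (if colLab b = γ then g b else 0) * f β c * S a b c) = 0 := by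
  rw [fold3]
  refine Finset.sum_eq_zero fun a _ => Finset.sum_eq_zero fun b _ => ?_
  by_cases h : colLab b = γ
  · rw [hV β a b (by rw [h]; exact hne)]; simp
  · rw [if_neg h]; simp

end Trunc

/-! ## The block free lunch -/

/-- **Alman–Li 2026 — the free lunch with a block functional** (Thm. 5.1 with `C'` spanned by
functionals `f_γ`, `γ ∈ P`, plus Prop. 5.3 block by block; the mechanism of the second proof of
Thm. 6.3 and of Lemma 7.2): if `T = (A ⊗ B ⊗ C) S` (`n = |ι'|`, `m = |κ'|`), every `f_γ` kills the
restriction (`(A ⊗ B ⊗ f_γ) S = 0`) and the matrices `M_γ = (id ⊗ id ⊗ f_γ) S` are supported on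
pairwise disjoint row blocks and column blocks (labellings `rowLab`, `colLab`), then
`T ⊕ ⊕_γ ⟨1, rank M_γ − n − m, 1⟩ ⊴ S`, the family direct sum of slices being
`blockSliceTensor K Sigma.fst` on `Σ γ, Fin (rank M_γ − (n+m))`.
[cite: AlmanLi2026, Thm. 5.1 with Prop. 5.3 (second proof of Thm. 6.3; proof of Lemma 7.2)] -/
theorem freeLunch_blockFunctional [Field K] [Fintype ι] [Fintype κ] [Fintype μ] [Fintype ι']
    [Fintype κ'] [Fintype μ'] [Fintype P] [DecidableEq P]
    {S : ι → κ → μ → K} {T : ι' → κ' → μ' → K} {A : ι' → ι → K} {B : κ' → κ → K}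
    {C₀ : μ' → μ → K}
    (hT : ∀ a' b' c', T a' b' c' = ∑ a, ∑ b, ∑ c, A a' a * B b' b * C₀ c' c * S a b c)
    (f : P → μ → K) (hf : ∀ γ a' b', (∑ a, ∑ b, ∑ c, A a' a * B b' b * f γ c * S a b c) = 0)
    (rowLab : ι → P) (colLab : κ → P)
    (hU : ∀ γ a b, rowLab a ≠ γ → (∑ c, f γ c * S a b c) = 0)
    (hV : ∀ γ a b, colLab b ≠ γ → (∑ c, f γ c * S a b c) = 0) :
    AlgDegeneratesTo S (directSumTensor T (blockSliceTensor K
      (Sigma.fst : (Σ γ : P, Fin ((Matrix.of fun a b => ∑ c, f γ c * S a b c).rank -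
        (Fintype.card ι' + Fintype.card κ'))) → P))) := by
  classical
  choose u v hu hv huv using fun γ => exists_annihilator_vectors S A B (f γ)
  refine thm51 (A := A) (B := B) (C₀ := C₀) (C' := f)
    (A' := fun x a => if rowLab a = x.1 then u x.1 x.2 a else 0)
    (B' := fun y b => if colLab b = y.1 then v y.1 y.2 b else 0)
    hT ?_ (fun a' b' γ => hf γ a' b') ?_ ?_
  · -- `(A'' ⊗ B'' ⊗ C') S` is the block one-slice tensor
    rintro ⟨γ, k⟩ ⟨β, l⟩ δ
    rw [blockSliceTensor_apply]
    by_cases hγδ : γ = δ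
    · subst hγδ
      rw [sum3_rowTrunc_self hU γ (u γ k)]
      by_cases hβγ : β = γ
      · subst hβγ
        rw [sum3_colTrunc_self hV β (u β k) (v β l), huv]
        by_cases hkl : k = l
        · subst hkl; simp
        · simp [hkl]
      · rw [sum3_colTrunc_ne hV hβγ]
        have hγβ : γ ≠ β := fun h => hβγ h.symm
        simp [hγβ]
    · rw [sum3_rowTrunc_ne hU hγδ]
      simp [hγδ]
  · -- the truncated `u`'s lie in every annihilator
    rintro ⟨γ, k⟩ b' β
    by_cases hγβ : γ = β
    · subst hγβ
      rw [sum3_rowTrunc_self hU γ (u γ k)]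
      exact hu γ k b'
    · exact sum3_rowTrunc_ne hU hγβ _ _
  · rintro a' ⟨γ, l⟩ β
    by_cases hγβ : γ = β
    · subst hγβ
      rw [sum3_colTrunc_self hV γ (A a') (v γ l)]
      exact hv γ a' l
    · exact sum3_colTrunc_ne hV hγβ _ _

end AlmanLi2026

end Literature.Computability.AlgebraicComplexity
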